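import Summits.QuantumFields.YangMills.Theorems.SwapVirialDeficitSwapRingCeilingBonds
import HarnessLib

/-!
# The fixed-`L` CEILING of the σ-glued ring, Ib: a small swap deficit forces the tree-gauged ring history INTO the σ-twisted nearly-commuting box
# (the converse of ✓`SwapRing.swapRingDeficit_le_of_commBox`; free-hands support of item stmt-QuantumFields-24197 `SwapVirialDeficit.SwapGluedStiffness`,
# brick (β-i) of LEAD ym-line-sfw-p2 g93's 05:57Z programme «(β) the log-free swap CEILING `μ^S{F^S ≤ t} ≤ C_L t^{9L⁴−1}`»)

In the tree-gauge coordinates `x = (w, r, g) ∈ X_fix` of a `2L`-slice ring history `P = (glue w ∷ r, g)` and with `δ = √F^S_0(P)` (sector `z = 0` of the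
σ-glued ring; part Ia ✓`SwapVirialDeficitSwapRingCeilingBonds` gives slices `4Lδ`, letters `12L²δ`, commuting wrap links `20L²δ`, and the per-link σ-seam
bound ✓`fd_swapSeam_le`):
* §3 the σ-SEAM: across a tree edge `e = (x, μ)` the seam field jumps by at most `16L²δ` (`swap_seam_jump`: the σ-image of a tree edge is a NON-crossing
  edge, whose glued value is `12L²δ`-close to `1`), so `g x` is within `48L³δ` of `c = g 0` (`swap_seam_near`, ✓`fd_sub_base_le_of_treeEdge`); across the
  wrap edge of direction `μ` the σ-image IS the wrap edge of direction `σμ` (`sitePerm_swap_single`), so `‖c·C_{σμ} − C_μ·c‖_F ≤ 52L³δ` (★ `swap_seam_wrap`)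
  — the σ-twisted intertwining `c C₁ ≈ C₀ c`, `c C₀ ≈ C₁ c`, `c C₂ ≈ C₂ c`;
* §4 ★★ `swapCommBox_of_swapRingDeficit` — the five box conditions of ✓`swapRingDeficit_le_of_commBox` with `s = 60L³δ`, `t₂ = 48L³δ`.
With the reversed Fubini bookkeeping of ✓`SwapRing.pi_real_mul_ballVol_pow_le_ringMeasure_real_swapDeficit_le` (sequel file) this gives
`μ_L{F^S_0 ≤ u} ≤ Haar⁴{σ-twisted leaders at 60L³√u}·ballVol(48L³√u)^{6L⁴−3}`, and with a σ-twisted four-leader CEILING `≤ C·s⁷` (LEAD g93, in progress)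
the log-free ceiling `μ_L{F^S_0 ≤ u} ≤ C_L·u^{9L⁴−1}` matching ✓`SwapRing.swap_volume_floor`.
HONEST LABEL: a deterministic Frobenius-norm estimate on a fixed lattice (sector `z = 0`; the seven twisted σ-sectors are NOT treated here); ⟨24197⟩, ⟨24194⟩,
⟨24497⟩, ⟨24196⟩ stay OPEN; no crux, rung or summit is proved; the Yang–Mills mass gap is NOT proved; no summit is proved by a line.  THEOREMS ONLY (0 `def`,
0 `sorry`), standard axioms.  Width seat ym-line-sfw-p2-w3 g61 (cell ym-idea-1, free hands), `--supports stmt-QuantumFields-24197`.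
References: [cite: tHooft1979]; [cite: Luscher1983, §2]; [cite: GonzalezarroyoAltes1988]; [folklore].
-/

set_option autoImplicit false

noncomputable section

open scoped Quaternion Matrix BigOperators Matrix.Norms.Frobenius
open Literature.MathematicalPhysics.QuantumFieldTheory hiding SU2
open Literature.MathematicalPhysics.QuantumLattice

namespace Summit.QuantumFields.YangMills.Theorems.SwapVirialDeficit.SwapRing

open Summit.QuantumFields.YangMills.Theorems.FemtoTransferGap
open Summit.QuantumFields.YangMills.Theorems.FemtoTransferGap.TT
open Summit.QuantumFields.YangMills.Theorems.FemtoTransferGap.TwoLattice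
open Summit.QuantumFields.YangMills.Theorems.FemtoTransferGap.TwoLattice.Flat
open Summit.QuantumFields.YangMills.Theorems.FemtoTransferGap.TwoLattice.Cov
open Summit.QuantumFields.YangMills.Theorems.VirialFluxGap.RingDeficit
open Summit.QuantumFields.YangMills.Theorems.ToronValleyVolume.Lojasiewicz
open Summit.QuantumFields.YangMills.Theorems.ToronValleyVolume.PeriodicRingCeiling
  (wrapReps_glue fd_one_eq frobNorm_comm_eq_fd frobNorm_inv_mul_sub_one_eq_fd mk3_wrap_eq_single)
open Summit.QuantumFields.YangMills.Theorems.SwapTwistDeficit.PeriodicRingFloor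

variable {L : ℕ} [NeZero L]
/-! ## §3 The σ-glued seam (sector `z = 0`): the seam field is nearly constant and intertwines the swap -/

omit [NeZero L] in
/-- The σ-image of an edge `(x, μ)` is the edge `(σ·x, σμ)`; its seam coordinate is the old one: `(σ·x)_{σμ} = x_μ`. [folklore] -/
theorem sitePerm_swap_apply_swap (x : Site 3 L) (μ : Fin 3) :
    sitePerm (Equiv.swap (0 : Fin 3) 1).symm x ((Equiv.swap (0 : Fin 3) 1).symm μ) = x μ := by
  simp only [sitePerm_apply, Equiv.symm_swap, Equiv.swap_apply_self]

omit [NeZero L] in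
/-- The σ-image of the wrap edge of direction `μ` is the wrap edge of direction `σμ`. [folklore] -/
theorem sitePerm_swap_single (μ : Fin 3) :
    sitePerm (Equiv.swap (0 : Fin 3) 1).symm (Pi.single μ (-1 : ZMod L)) = Pi.single ((Equiv.swap (0 : Fin 3) 1) μ) (-1 : ZMod L) := by
  funext j
  simp only [sitePerm_apply, Equiv.symm_symm, Pi.single_apply]
  by_cases h : j = Equiv.swap (0 : Fin 3) 1 μ
  · subst h; simp
  · rw [if_neg h, if_neg]
    intro h'
    apply h
    rw [← h', Equiv.swap_apply_self]

/-- `‖cAc⁻¹ − B‖_F = ‖cA − Bc‖_F` (right unitary invariance). [folklore] -/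
theorem frobNorm_conj_sub_eq (c A B : SU2) :
    frobNorm (((c * A * c⁻¹ : SU2) : Matrix (Fin 2) (Fin 2) ℂ) - (B : Matrix (Fin 2) (Fin 2) ℂ)) =
      frobNorm (((c * A : SU2) : Matrix (Fin 2) (Fin 2) ℂ) - ((B * c : SU2) : Matrix (Fin 2) (Fin 2) ℂ)) := by
  have e1 : fd (c * A * c⁻¹) B = fd (c * A * c⁻¹ * c) (B * c) := (fd_mul_right c _ _).symm
  rw [inv_mul_cancel_right] at e1
  exact e1

/-- **Seam jumps**: in sector `0`, across every tree edge `e = (x, μ)` the seam field jumps by at most `16L²·√F^S_0` — the σ-glued seam bond compares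
`1 = (glue w)(e)` with `g x · (glue w)(σe) · g(x+ê_μ)⁻¹`, and the σ-image `σe` of a tree edge is a non-crossing edge, glued within `12L²√F^S` of `1`.
[cite: tHooft1979] [cite: Luscher1983, §2] -/
theorem swap_seam_jump (w : OffIdx L → SU2) (r : Fin (2 * L - 1) → GaugeConfig 3 L SU2) (g : Site 3 L → SU2)
    (e : Edge 3 L) (he : treeEdge e = true) :
    fd (g (e.1.shift e.2)) (g e.1) ≤
      16 * (L : ℝ) ^ 2 * Real.sqrt (swapRingDeficit L (fun _ => false) ((Fin.cons (glue w) r : Fin (2 * L - 1 + 1) → GaugeConfig 3 L SU2), g)) := by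
  set σ : Equiv.Perm (Fin 3) := Equiv.swap (0 : Fin 3) 1 with hσ
  set P : (Fin (2 * L - 1 + 1) → GaugeConfig 3 L SU2) × (Site 3 L → SU2) := (Fin.cons (glue w) r, g) with hP
  set δ := Real.sqrt (swapRingDeficit L (fun _ => false) P) with hδ
  have hδ0 : 0 ≤ δ := Real.sqrt_nonneg _
  have hL1 : (1 : ℝ) ≤ L := by exact_mod_cast NeZero.one_le
  have hP1 : P.1 0 = glue w := rfl
  -- the σ-image edge of `e`
  set e' : Edge 3 L := (sitePerm σ.symm e.1, σ.symm e.2) with he'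
  have he'x : e'.1 e'.2 = e.1 e.2 := sitePerm_swap_apply_swap e.1 e.2
  have hne : e'.1 e'.2 ≠ -1 := by rw [he'x]; exact apply_ne_neg_one_of_treeEdge he
  -- the glued value on `e'` is `12L²δ`-close to `1`
  have hglue' : fd (glue w e') 1 ≤ 12 * (L : ℝ) ^ 2 * δ := by
    by_cases ht : treeEdge e' = true
    · rw [glue_apply_of_tree w ht, fd_self]; positivity
    · have h := swap_letters_near (fun _ => false) w r g ⟨e', ht⟩
      simp only [if_neg hne, inv_one, one_mul] at h
      rw [glue_apply_of_not_tree w ht, fd_one_eq]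
      exact h
  -- the seam inequality on `e`
  have h1 := fd_swapSeam_le (fun _ => false) P e
  rw [hP1, twist3_false, glue_apply_of_tree w he] at h1
  have e1 : gaugeTransform g (configPerm σ (glue w)) e = g e.1 * glue w e' * (g (e.1.shift e.2))⁻¹ := by
    rw [show gaugeTransform g (configPerm σ (glue w)) e = g e.1 * configPerm σ (glue w) e * (g (e.1.shift e.2))⁻¹ from rfl,
      configPerm_apply]
  have hP2 : P.2 = g := rfl
  rw [hP2, e1] at h1
  -- compare with `g x · 1 · g(x')⁻¹`
  have h2 : fd (g e.1 * glue w e' * (g (e.1.shift e.2))⁻¹) (g e.1 * 1 * (g (e.1.shift e.2))⁻¹) = fd (glue w e') 1 := by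
    rw [fd_mul_right, fd_mul_left]
  have h3 : fd 1 (g e.1 * 1 * (g (e.1.shift e.2))⁻¹) ≤ 4 * (L : ℝ) * δ + 12 * (L : ℝ) ^ 2 * δ := by
    calc fd 1 (g e.1 * 1 * (g (e.1.shift e.2))⁻¹)
        ≤ fd 1 (g e.1 * glue w e' * (g (e.1.shift e.2))⁻¹) +
            fd (g e.1 * glue w e' * (g (e.1.shift e.2))⁻¹) (g e.1 * 1 * (g (e.1.shift e.2))⁻¹) := fd_triangle _ _ _
      _ ≤ 4 * (L : ℝ) * δ + 12 * (L : ℝ) ^ 2 * δ := by rw [h2]; exact add_le_add h1 hglue'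
  rw [mul_one, fd_comm, fd_mul_inv_one] at h3
  rw [fd_comm]
  have hLδ : (L : ℝ) * δ ≤ (L : ℝ) ^ 2 * δ := mul_le_mul_of_nonneg_right (by nlinarith) hδ0
  calc fd (g e.1) (g (e.1.shift e.2)) ≤ 4 * (L : ℝ) * δ + 12 * (L : ℝ) ^ 2 * δ := h3
    _ ≤ 16 * (L : ℝ) ^ 2 * δ := by linarith

/-- **Seam**: in sector `0` every seam value is within `48L³·√F^S_0` of `c = g 0`. [cite: Luscher1983, §2] -/
theorem swap_seam_near (w : OffIdx L → SU2) (r : Fin (2 * L - 1) → GaugeConfig 3 L SU2) (g : Site 3 L → SU2) (x : Site 3 L) :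
    frobNorm ((((g 0)⁻¹ * g x : SU2) : Matrix (Fin 2) (Fin 2) ℂ) - 1) ≤
      48 * (L : ℝ) ^ 3 * Real.sqrt (swapRingDeficit L (fun _ => false) ((Fin.cons (glue w) r : Fin (2 * L - 1 + 1) → GaugeConfig 3 L SU2), g)) := by
  set δ := Real.sqrt (swapRingDeficit L (fun _ => false) ((Fin.cons (glue w) r : Fin (2 * L - 1 + 1) → GaugeConfig 3 L SU2), g)) with hδ
  have hδ0 : 0 ≤ δ := Real.sqrt_nonneg _
  have hL1 : (1 : ℝ) ≤ L := by exact_mod_cast NeZero.one_le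
  have hρ0 : 0 ≤ 16 * (L : ℝ) ^ 2 * δ := by positivity
  rw [frobNorm_inv_mul_sub_one_eq_fd]
  calc fd (g x) (g 0) ≤ 3 * ((L : ℝ) - 1) * (16 * (L : ℝ) ^ 2 * δ) :=
      fd_sub_base_le_of_treeEdge hρ0 (fun e he => swap_seam_jump w r g e he) x
    _ ≤ 48 * (L : ℝ) ^ 3 * δ := by nlinarith [pow_nonneg (le_trans zero_le_one hL1) 2]

/-- **The σ-twisted intertwining of the leaders**: in sector `0`, `‖c·C_{σμ} − C_μ·c‖_F ≤ 52L³·√F^S_0` for the seam value `c = g 0` and the wrap links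
`C_μ = w(−ê_μ, μ)` — the σ-image of the wrap edge of direction `μ` IS the wrap edge of direction `σμ` (`c C₁ ≈ C₀ c`, `c C₀ ≈ C₁ c`, `c C₂ ≈ C₂ c`).
[cite: tHooft1979] [cite: GonzalezarroyoAltes1988] -/
theorem swap_seam_wrap (w : OffIdx L → SU2) (r : Fin (2 * L - 1) → GaugeConfig 3 L SU2) (g : Site 3 L → SU2) (μ : Fin 3) :
    frobNorm (((g 0 * w ⟨(Pi.single (Equiv.swap (0 : Fin 3) 1 μ) (-1 : ZMod L), Equiv.swap (0 : Fin 3) 1 μ),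
        leader_not_treeEdge (Equiv.swap (0 : Fin 3) 1 μ)⟩ : SU2) : Matrix (Fin 2) (Fin 2) ℂ) -
      ((w ⟨(Pi.single μ (-1 : ZMod L), μ), leader_not_treeEdge μ⟩ * g 0 : SU2) : Matrix (Fin 2) (Fin 2) ℂ)) ≤
      52 * (L : ℝ) ^ 3 * Real.sqrt (swapRingDeficit L (fun _ => false) ((Fin.cons (glue w) r : Fin (2 * L - 1 + 1) → GaugeConfig 3 L SU2), g)) := by
  set σ : Equiv.Perm (Fin 3) := Equiv.swap (0 : Fin 3) 1 with hσ
  set P : (Fin (2 * L - 1 + 1) → GaugeConfig 3 L SU2) × (Site 3 L → SU2) := (Fin.cons (glue w) r, g) with hP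
  set δ := Real.sqrt (swapRingDeficit L (fun _ => false) P) with hδ
  have hδ0 : 0 ≤ δ := Real.sqrt_nonneg _
  have hL1 : (1 : ℝ) ≤ L := by exact_mod_cast NeZero.one_le
  have hP1 : P.1 0 = glue w := rfl
  have hP2 : P.2 = g := rfl
  set c : SU2 := g 0 with hc
  set C : Fin 3 → SU2 := fun ν => w ⟨(Pi.single ν (-1 : ZMod L), ν), leader_not_treeEdge ν⟩ with hC
  -- the wrap edge `(m, μ)` ends at the origin and its σ-image is the wrap edge of direction `σμ`
  set m : Site 3 L := Pi.single μ (-1 : ZMod L) with hm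
  have hshift : m.shift μ = 0 := by
    have h := wrapEdge_shift (L := L) μ
    rwa [mk3_wrap_eq_single] at h
  have hwμ : glue w (m, μ) = C μ := by rw [hC]; exact glue_apply_of_not_tree w (leader_not_treeEdge μ)
  have hwσ : configPerm σ (glue w) (m, μ) = C (σ μ) := by
    rw [configPerm_apply, hm, sitePerm_swap_single]
    exact glue_apply_of_not_tree w (leader_not_treeEdge (σ μ))
  -- the seam inequality on the wrap edge
  have h1 := fd_swapSeam_le (fun _ => false) P (m, μ)
  rw [hP1, hP2, twist3_false, hwμ] at h1
  have e1 : gaugeTransform g (configPerm σ (glue w)) (m, μ) = g m * C (σ μ) * c⁻¹ := by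
    rw [show gaugeTransform g (configPerm σ (glue w)) (m, μ) = g m * configPerm σ (glue w) (m, μ) * (g (m.shift μ))⁻¹ from rfl,
      hwσ, hshift]
  rw [e1] at h1
  -- `g m` is close to `c`
  have h2 : fd (g m) c ≤ 48 * (L : ℝ) ^ 3 * δ := by
    have h := swap_seam_near w r g m
    rw [frobNorm_inv_mul_sub_one_eq_fd] at h
    exact h
  have h3 : fd (g m * C (σ μ) * c⁻¹) (c * C (σ μ) * c⁻¹) = fd (g m) c := by rw [fd_mul_right, fd_mul_right]
  have h4 : fd (C μ) (c * C (σ μ) * c⁻¹) ≤ 4 * (L : ℝ) * δ + 48 * (L : ℝ) ^ 3 * δ := by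
    calc fd (C μ) (c * C (σ μ) * c⁻¹) ≤ fd (C μ) (g m * C (σ μ) * c⁻¹) + fd (g m * C (σ μ) * c⁻¹) (c * C (σ μ) * c⁻¹) := fd_triangle _ _ _
      _ ≤ 4 * (L : ℝ) * δ + 48 * (L : ℝ) ^ 3 * δ := by rw [h3]; exact add_le_add h1 h2
  rw [← frobNorm_conj_sub_eq]
  have e2 : frobNorm (((c * C (σ μ) * c⁻¹ : SU2) : Matrix (Fin 2) (Fin 2) ℂ) - (C μ : Matrix (Fin 2) (Fin 2) ℂ)) = fd (c * C (σ μ) * c⁻¹) (C μ) := rfl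
  rw [e2, fd_comm]
  calc fd (C μ) (c * C (σ μ) * c⁻¹) ≤ 4 * (L : ℝ) * δ + 48 * (L : ℝ) ^ 3 * δ := h4
    _ ≤ 52 * (L : ℝ) ^ 3 * δ := by nlinarith [pow_nonneg (le_trans zero_le_one hL1) 3, pow_le_pow_right₀ hL1 (show 1 ≤ 3 by norm_num)]

/-! ## §4 The σ-twisted nearly-commuting box from a small swap deficit -/

/-- ★★ **A small swap deficit puts the tree-gauged ring history INTO the σ-twisted nearly-commuting box** (converse of
✓`swapRingDeficit_le_of_commBox`, sector `z = 0`): with `δ = √F^S_0(glue w ∷ r, g)`, the wrap links pairwise commute up to `60L³δ`, the seam value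
`g 0` intertwines the swap up to `60L³δ` (`‖g(0)·C_{σμ} − C_μ·g(0)‖_F`), the other off-tree links of slice `0` are within `48L³δ` of their letters, the slices
within `48L³δ` of slice `0`, the seam within `48L³δ` of `g 0`. [cite: tHooft1979] [cite: Luscher1983, §2] [cite: GonzalezarroyoAltes1988] -/
theorem swapCommBox_of_swapRingDeficit (w : OffIdx L → SU2) (r : Fin (2 * L - 1) → GaugeConfig 3 L SU2) (g : Site 3 L → SU2) :
    (∀ μ ν : Fin 3,
      frobNorm (((w ⟨(Pi.single μ (-1 : ZMod L), μ), leader_not_treeEdge μ⟩ * w ⟨(Pi.single ν (-1 : ZMod L), ν), leader_not_treeEdge ν⟩ : SU2) :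
          Matrix (Fin 2) (Fin 2) ℂ) -
        ((w ⟨(Pi.single ν (-1 : ZMod L), ν), leader_not_treeEdge ν⟩ * w ⟨(Pi.single μ (-1 : ZMod L), μ), leader_not_treeEdge μ⟩ : SU2) :
          Matrix (Fin 2) (Fin 2) ℂ)) ≤
        60 * (L : ℝ) ^ 3 * Real.sqrt (swapRingDeficit L (fun _ => false) ((Fin.cons (glue w) r : Fin (2 * L - 1 + 1) → GaugeConfig 3 L SU2), g))) ∧
    (∀ μ : Fin 3,
      frobNorm (((g 0 * w ⟨(Pi.single (Equiv.swap (0 : Fin 3) 1 μ) (-1 : ZMod L), Equiv.swap (0 : Fin 3) 1 μ),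
          leader_not_treeEdge (Equiv.swap (0 : Fin 3) 1 μ)⟩ : SU2) : Matrix (Fin 2) (Fin 2) ℂ) -
        ((w ⟨(Pi.single μ (-1 : ZMod L), μ), leader_not_treeEdge μ⟩ * g 0 : SU2) : Matrix (Fin 2) (Fin 2) ℂ)) ≤
        60 * (L : ℝ) ^ 3 * Real.sqrt (swapRingDeficit L (fun _ => false) ((Fin.cons (glue w) r : Fin (2 * L - 1 + 1) → GaugeConfig 3 L SU2), g))) ∧
    (∀ i : OffIdx L, frobNorm ((((if i.1.1 i.1.2 = -1 then w ⟨(Pi.single i.1.2 (-1 : ZMod L), i.1.2), leader_not_treeEdge i.1.2⟩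
        else 1)⁻¹ * w i : SU2) : Matrix (Fin 2) (Fin 2) ℂ) - 1) ≤
        48 * (L : ℝ) ^ 3 * Real.sqrt (swapRingDeficit L (fun _ => false) ((Fin.cons (glue w) r : Fin (2 * L - 1 + 1) → GaugeConfig 3 L SU2), g))) ∧
    (∀ (j : Fin (2 * L - 1)) (e : Edge 3 L), frobNorm ((((glue w e)⁻¹ * r j e : SU2) : Matrix (Fin 2) (Fin 2) ℂ) - 1) ≤
        48 * (L : ℝ) ^ 3 * Real.sqrt (swapRingDeficit L (fun _ => false) ((Fin.cons (glue w) r : Fin (2 * L - 1 + 1) → GaugeConfig 3 L SU2), g))) ∧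
    (∀ x, frobNorm ((((g 0)⁻¹ * g x : SU2) : Matrix (Fin 2) (Fin 2) ℂ) - 1) ≤
        48 * (L : ℝ) ^ 3 * Real.sqrt (swapRingDeficit L (fun _ => false) ((Fin.cons (glue w) r : Fin (2 * L - 1 + 1) → GaugeConfig 3 L SU2), g))) := by
  have hδ0 : 0 ≤ Real.sqrt (swapRingDeficit L (fun _ => false) ((Fin.cons (glue w) r : Fin (2 * L - 1 + 1) → GaugeConfig 3 L SU2), g)) :=
    Real.sqrt_nonneg _
  have hL1 : (1 : ℝ) ≤ L := by exact_mod_cast NeZero.one_le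
  have hL2 : (1 : ℝ) ≤ (L : ℝ) ^ 2 := one_le_pow₀ hL1
  have hL3 : (L : ℝ) ^ 2 ≤ (L : ℝ) ^ 3 := pow_le_pow_right₀ hL1 (by norm_num)
  have h20 : 20 * (L : ℝ) ^ 2 ≤ 60 * (L : ℝ) ^ 3 := by nlinarith
  have h52 : 52 * (L : ℝ) ^ 3 ≤ 60 * (L : ℝ) ^ 3 := by nlinarith
  have h12 : 12 * (L : ℝ) ^ 2 ≤ 48 * (L : ℝ) ^ 3 := by nlinarith
  have h4 : 4 * (L : ℝ) ≤ 48 * (L : ℝ) ^ 3 := by nlinarith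
  exact ⟨fun μ ν => (swap_wraps_comm (fun _ => false) w r g μ ν).trans (mul_le_mul_of_nonneg_right h20 hδ0),
    fun μ => (swap_seam_wrap w r g μ).trans (mul_le_mul_of_nonneg_right h52 hδ0),
    fun i => (swap_letters_near (fun _ => false) w r g i).trans (mul_le_mul_of_nonneg_right h12 hδ0),
    fun j e => (swap_slices_near (fun _ => false) w r g j e).trans (mul_le_mul_of_nonneg_right h4 hδ0),
    fun x => swap_seam_near w r g x⟩

end Summit.QuantumFields.YangMills.Theorems.SwapVirialDeficit.SwapRing

end
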